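import Literature.Computability.FineGrained.Conjectures
import Literature.Computability.FineGrained.MinPlusProductToAPSP
import Literature.Computability.FineGrained.APSPToMinPlusProduct
import Literature.Computability.Cryptography.FGComplexityRefutation
import Literature.Computability.FineGrained.KOVFromSETH
import HarnessLib

/-!
# Fine-grained conjectures: proofs for `Conjectures` (the 3SUM conjecture, `fine-grained.S10`; APSP `≡₃` distance product, `fine-grained.S12`; the uncorrected transfer property `fine-grained.S13` refuted)

Companion to `Literature.Computability.FineGrained.Conjectures` (theorems only).

## Status of `ThreeSUMConjecture` (provefact audit)

`Literature.Computability.FineGrained.ThreeSUMConjecture` is an *open hypothesis*: it is printed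
as a conjecture and proved nowhere, so it has no discharge `ThreeSUMConjecture_holds`; it is
vendored as a `def … : Prop` to be used as a hypothesis `(h : ThreeSUMConjecture)`. Sources, as
printed:

* M. Pătraşcu, *Towards polynomial lower bounds for dynamic problems*, STOC 2010, §1.3,
  **Conjecture 6 (3SUM-hardness)**: "In the Word RAM model with words of `O(lg n)` bits, any
  algorithm requires `n^{2-o(1)}` time in expectation to determine whether a set
  `S ⊂ {-n³, …, n³}` of `|S| = n` integers contains a triple of distinct `x, y, z ∈ S` with
  `x + y = z`." Loc. cit. assumes zero-error expected time "for maximal generality" and notes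
  that "it is also possible to build a theory based on bounded-error hardness", and that by
  hashing "the Word RAM version of the 3SUM conjecture need only talk about a universe of
  `u = O(n³)`". [cite: Patrascu2010, §1.3 Conjecture 6]
* V. Vassilevska Williams, IPEC 2015 (LIPIcs 43), §2.1, Conjecture 1: the same wording.
* A. Abboud, K. Lewi, *Exact weight subgraphs and the `k`-SUM conjecture*, ICALP 2013, §1,
  **Conjecture 1 (the `k`-SUM conjecture)**: "There does not exist a `k ≥ 2`, an `ε > 0`, and a
  randomized algorithm that succeeds (with high probability) in solving `k`-SUM in time
  `O(n^{⌈k/2⌉-ε})`." [cite: AbboudLewi2013, §1 Conjecture 1]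

The vendored statement `∀ ε > 0, ¬ threeSUM.RandInTimeO (n ↦ n^{2-ε})` is the bounded-error
(success probability `≥ 2/3`), worst-case-time, "for every `ε > 0`" form over Pătraşcu's range
`{-n³, …, n³}` with the Gajentaan–Overmars formulation (three entries at distinct positions
summing to `0`): literally the `k = 3` case of the vendored `k`-SUM conjecture
(`threeSUMConjecture_iff_kSUMConjecture_three`). Relative to Pătraşcu's Conjecture 6 it differs
in three respects that print treats as interchangeable but which are not definitional here:
(a) `a + b + c = 0` on a list vs. distinct `x + y = z` in a set; (b) bounded-error worst-case vs.
zero-error expected running time (the bounded-error hypothesis is formally the stronger one: a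
zero-error algorithm with expected time `T` stopped after `3T` steps errs with probability
`≤ 1/3`); (c) "not `O(n^{2-ε})` for any `ε > 0`" vs. "`n^{2-o(1)}`".

## Contents

* `threeSUM_eq_kSUM_three`: the zoo problems `threeSUM` and `kSUM 3` coincide;
* `threeSUMConjecture_iff_kSUMConjecture_three`: `ThreeSUMConjecture ↔ KSUMConjecture 3`;
* `threeSUMConjecture_of_kSUMConjectureAll`: the `k`-SUM conjecture implies the 3SUM conjecture;
* `threeSUMConjectureDet_iff_kSUM_three`: the deterministic analogue.

## VW–W 2018, Thm. 1.1, (1) ⟺ (5): `subcubicEquivalent_APSP_minPlusProduct_holds`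

**`subcubicEquivalent_APSP_minPlusProduct_holds`** discharges the named fact
`subcubicEquivalent_APSP_minPlusProduct` of `Conjectures` (suite item `fine-grained.S12`) —
Vassilevska Williams–Williams, J. ACM 65 (2018), Thm. 1.1, (1) ⟺ (5): APSP and the `(min,+)`-product of
`n × n` matrices with entries in `[-nᶜ, nᶜ]` are subcubically equivalent, up to a polynomial change
of the weight exponent (`SubcubicEquivalentFamily APSP MinPlusProduct`). Both halves are verified
word-RAM oracle programs, landed in their own files:

* `APSPPower.APSP_fgReducible_minPlusProduct_holds`
  (`Literature.Computability.FineGrained.APSPToMinPlusProduct`): APSP `≤₃` distance product by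
  `⌈log₂ n⌉` oracle products (§2 p. 27:8, after Fischer–Meyer [28]); weight exponent `c' = c + 1`;
* `minPlusProduct_fgReducible_APSP_holds`
  (`Literature.Computability.FineGrained.MinPlusProductToAPSP`): distance product `≤₃` APSP by the
  program `MinPlusToAPSP.prog`, one APSP query on the product layered graph
  (`Literature.Computability.Cryptography.ProductLayeredGraph`, the directed rendering of the
  tripartite gadget of the proof of Thm. 5.1, p. 27:22); `c' = c`.

They are glued by `subcubicEquivalent_APSP_minPlusProduct_of_reductions`
(`Literature.Computability.FineGrained.SubcubicEquivalencesAPSP`). The theorem lives here and not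
in `Conjectures` because both proof files import `Conjectures` transitively.

## Status of `trulySubTime_of_fgReducible` (provefact audit): refuted as stated, `fine-grained.S13`

The uncorrected transfer property `fine-grained.S13` as first transcribed in
`Literature.Computability.FineGrained.Conjectures` — until 2026-08-15 the named fact
`Literature.Computability.FineGrained.trulySubTime_of_fgReducible` of that file, which the verdict
clean-up of `Conjectures` retires from the fact ledger (a refuted named fact can never be
discharged) — has **no discharge**: it is false in the word-RAM model of
`Literature.Computability.Cryptography.WordRAM`, kernel-checked as the prelude's
**`FGReducible.trulySubTime_false`**
(`Literature.Computability.Cryptography.FGComplexityRefutation`), which states the refuted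
proposition *verbatim, inlined* — binder for binder the body of the retired fact — so that nothing
depends on the retired name. (Until 2026-08-15 this file also restated that
theorem under the name `trulySubTime_of_fgReducible_false`; the restatement was removed as a
duplicate, ledger item `dedup-00451`: use `FGReducible.trulySubTime_false`.) Source, as printed
(V. Vassilevska Williams, *On some fine-grained questions in algorithms and complexity*,
Proc. ICM 2018, §2.2):

* **Definition 2.1 (Fine-grained reduction).** "Assume that `A` and `B` are computational problems
  and `a(n)` and `b(n)` are their conjectured running time lower bounds, respectively. Then we say
  `A` `(a, b)`-reduces to `B`, `A ≤_{a,b} B`, if for every `ε > 0`, there exists `δ > 0`, and an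
  algorithm `R` for `A` that runs in time `a(n)^{1-δ}` *on inputs of length `n`*, making `q` calls
  to an oracle for `B` with query lengths `n₁, …, n_q`, where `∑ᵢ (b(nᵢ))^{1-ε} ≤ (a(n))^{1-δ}`."
* **The remark following it** (the transfer property; there is no numbered proposition in print,
  the docstring of the fact calls it "Prop. 2.1"): "The definition implies that if `A ≤_{a,b} B` and
  `B` has an algorithm with running time `O(b(n)^{1-ε})`, then, `A` can be solved by replacing the
  oracle calls by the corresponding runs of the algorithm, obtaining a runtime of `O(a(n)^{1-δ})`
  for `A` for some `δ > 0`."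
* **The standing model** (§1, "The Fine-Grained Question"): "From now on let us fix the
  computational model to a word-RAM with `O(log n)` bit words", running times being measured "on
  inputs of size `n`". [cite: VassilevskaWilliamsICM2018, §2.2 Def. 2.1 and the remark following it; §1]

The discrepancy. In print `n` is the input length and words have `Θ(log n)` bits, so `n`, the
budget `a(n)^{1-δ}` and every query length are numbers of `O(1)` machine words. The vendored
`FGProblem` decouples the size measure `size` from the encoding `encode`, and the fact quantifies
over *all* pairs of well-formed problems (`IsStandard` bounds `|encode x|` and the width only from
above in terms of `n = size x`), including problems whose size measure is not word-representable.
For those the transfer fails in the exact model (`WordRAM.step` stores the length of an oracle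
answer unreduced): `Literature.Computability.Cryptography.FGComplexityRefutation` builds
`(univA, n¹) ≤_FG (univB, n²)` with `univB` truly sub-`n²`, both problems well formed, and `univA`
solved by no word-RAM program in any time bound (diagonalisation through the universal program),
`FGReducible.trulySubTime_false` — whose negated proposition is, binder for binder, the body of
the retired fact (budgets `n^α`, `n^β`, hypotheses `IsStandard` only); it is paired with the
corrected statement in `trulySubTime_of_fgReducible_of_sizeFitsWord_holds_and_not` below. The
faithful transcription of print carries the lost hypothesis
`A.SizeFitsWord` ("`n` fits in `O(1)` words"): `trulySubTime_of_fgReducible_of_sizeFitsWord` in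
`Conjectures`, proved there (`trulySubTime_of_fgReducible_of_sizeFitsWord_holds`, by the verified
inline simulation of `Literature.Computability.Cryptography.FGComplexityProofs`); every zoo
problem satisfies `SizeFitsWord` (`APSP_sizeFitsWord`, …), so no printed consequence is affected.

The same counterexample run with the common budget `n³` on both sides
(`exists_subcubicEquivalent_not_trulySubTime`, constant families) refutes the uncorrected family
version as well (VW–W, J. ACM 65 (2018), Thm. 1.1 pattern "either all of them have truly subcubic
algorithms, or none of them do", transcribed for *arbitrary* families of well-formed problems
without `SizeFitsWord` hypotheses; until 2026-08-15 the named fact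
`SubcubicEquivalentFamily.trulySubTime_iff` of `Conjectures`, which the verdict clean-up turns into
a deprecated alias of the corrected theorem): **`SubcubicEquivalentFamily.trulySubTime_iff_false`**,
again with the refuted proposition inlined (corrected and proved:
`SubcubicEquivalentFamily.trulySubTime_iff_of_sizeFitsWord_holds` in `Conjectures`).

## Status of `OVConjectureDet` (provefact audit, 2026-08-15)

`Literature.Computability.FineGrained.OVConjectureDet` — "for every `ε > 0` there is `c ≥ 1` such
that OV on `n` vectors of dimension `d = c ⌊log₂ n⌋` (`OVWithDim c`) has no deterministic
`O(n^{2-ε})`-time word-RAM algorithm" — is an *open hypothesis*: it is printed as a conjecture and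
proved nowhere, so it has no discharge `OVConjectureDet_holds`; it is vendored as a `def … : Prop`
to be used as a hypothesis `(h : OVConjectureDet)`, or obtained from the stronger hypotheses
`OVConjecture` (`ovConjectureDet_of_ovConjecture_holds`) and word-RAM SETH (the named fact
`ovConjectureDet_of_sethWordRAM` of `SETHHardness.lean`). What the sources print:

* R. Williams, *A new algorithm for optimal 2-constraint satisfaction and its implications*,
  TCS 348 (2005), §5.1, **Theorem 5** (numbering of the author's version, p. 9; cited as Thm. 5.1
  in `SETHHardness.lean`): "Let `f` be time constructible. If the cooperative subset query
  problem with `d = |U|` and `k = max{|D₁|, |D₂|}` is solvable in `Õ(f(d) k^{2-ε})` time, then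
  CNF-SAT is in `Õ(f(m) 2^{(1-ε/2)n})` time, where `m` is the number of clauses and `n` is the
  number of variables." This is a *conditional* — the
  split-and-list reduction behind "SETH ⇒ OVC" (cooperative subset queries are OV after
  complementing one side), vendored as `ovConjectureDet_of_sethWordRAM` and assembled from its two
  machine-level ingredients in `OVFromSETH.lean`; loc. cit. prints no unconditional lower bound
  for OV. [cite: WilliamsTCS2005, §5.1 Thm. 5]
* V. Vassilevska Williams, IPEC 2015 (LIPIcs 43), §2.4, **Conjecture 4 (OVC)**: "In the Word RAM
  model with `O(log n)` bit words, any algorithm requires `n^{2-o(1)}` time in expectation to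
  determine whether a set of `n` vectors over `{0,1}^d` for `d = ω(log n)` contains an orthogonal
  pair", introduced with "No reduction is known from OV to CNF-SAT, and the OV problem may require
  essentially quadratic time even if SETH is false. Thus it is often better to base hardness on the
  following OV conjecture", and preceded by "the best known algorithm [Abboud–Williams–Yu,
  SODA 2015] runs slightly faster, in `O(n^{2-1/O(log(d/log n))})` time" — for each fixed `c`, OV in
  dimension `c log n` *is* truly subquadratic, with a saving `1/O(log c)` that vanishes as `c`
  grows, whence the `∀ ε ∃ c` shape of the vendored statement.
  [cite: VassilevskaWilliamsIPEC2015, §2.4 Conjecture 4]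
* V. Vassilevska Williams, Proc. ICM 2018, §3, Hypothesis 2: the randomised `d = c log n`,
  "for every `ε > 0` there is `c ≥ 1`" wording, vendored as `OVConjecture`; `OVConjectureDet` is its
  deterministic weakening. [cite: VassilevskaWilliamsICM2018, §3 Hypothesis 2]

So the vendored statement is faithful (not mis-stated) and not dischargeable: a proof for a single
`ε < 1` would be a superlinear worst-case time lower bound for an explicit problem on the word RAM,
and a refutation (a saving `ε > 0` uniform in `c`) would refute word-RAM SETH by
`ovConjectureDet_of_sethWordRAM`. What *is* proved here is the identification, used informally
throughout the sources and in `KOVFromSETH.lean` ("up to the identification of `kOVWithDim 2 c`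
with `OVWithDim c`"), of the OV hypothesis with the `k = 2` case of the `k`-OV hypothesis (same
input words, size and answers, so the same word-RAM program serves both problems):

* `inTimeInst_of_instanceMap`, `inTime_of_instanceMap`, `inTimeO_of_instanceMap`: deterministic
  running-time bounds transfer along maps of instances preserving encoding, size and accepted
  outputs (the same program is run);
* `KOVInstance.encode_two_eq`, `OVInstance.encode_eq_kOV_two`,
  `KOVInstance.hasOrthogonalTuple_two_iff`, `kOV_two_good_eq`, `OV_good_eq_kOV_two`: a `2`-OV
  instance and the OV instance with lists `vecs 0`, `vecs 1` have the same input words and the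
  same answer;
* `kOVWithDim_two_inTimeO_iff`: `(kOVWithDim 2 c).InTimeO t ↔ (OVWithDim c).InTimeO t`;
* `ovConjectureDet_iff_kOVWithDim_two`: `OVConjectureDet` is verbatim the `k = 2` slice of the
  conclusion of `not_kOVWithDim_inTimeO_of_sethWordRAM`; `ovConjectureDet_iff_forall_le_one`:
  savings `ε ≤ 1` suffice (`inTimeO_rpow_two_sub_anti`);
* `ovConjectureDet_of_sethWordRAM_of_kOV`, `sparseKSATInRAMTime_of_ov_subquadratic_of_kOV`: the
  two-list named facts `ovConjectureDet_of_sethWordRAM` (`SETHHardness.lean`) and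
  `sparseKSATInRAMTime_of_ov_subquadratic` (`OVFromSETH.lean`) follow from the `k`-list named facts
  `not_kOVWithDim_inTimeO_of_sethWordRAM`, `sparseKSATInRAMTime_of_kOV_inTimeO` at `k = 2` (so
  discharging the latter discharges the former).
-/

namespace Literature.Computability.FineGrained

open Cryptography

/-- The zoo problems `threeSUM` and `kSUM 3` coincide: same instances (integer lists with entries
in `[-n³, n³]`), encoding, size and accepted outputs (`HasThreeSum l ↔ HasKSum 3 l`,
`hasThreeSum_iff_hasKSum_three`). [folklore] -/
theorem threeSUM_eq_kSUM_three : threeSUM = kSUM 3 := by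
  have h : HasThreeSum = HasKSum 3 := funext fun l => propext (hasThreeSum_iff_hasKSum_three l)
  unfold threeSUM kSUM
  rw [h]

/-- **fine-grained.S10 = S17 at `k = 3`** (Abboud–Lewi, ICALP 2013, §1, Conjecture 1 and the
paragraph following it, "The `k = 3` case has received even more attention …"): the 3SUM
conjecture is the `k = 3` instance of the `k`-SUM conjecture (exponent `⌈3/2⌉ = 2`, and
`threeSUM = kSUM 3`). [cite: AbboudLewi2013, §1 Conjecture 1] -/
theorem threeSUMConjecture_iff_kSUMConjecture_three : ThreeSUMConjecture ↔ KSUMConjecture 3 := by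
  rw [kSUMConjecture_three_iff, ThreeSUMConjecture, threeSUM_eq_kSUM_three]

/-- The `k`-SUM conjecture (all `k ≥ 3`, `KSUMConjectureAll`) implies the 3SUM conjecture.
[cite: AbboudLewi2013, §1 Conjecture 1] -/
theorem threeSUMConjecture_of_kSUMConjectureAll (h : KSUMConjectureAll) : ThreeSUMConjecture :=
  threeSUMConjecture_iff_kSUMConjecture_three.2 (h 3 le_rfl)

/-- Deterministic analogue: the deterministic 3SUM conjecture says that `kSUM 3` has no
deterministic `O(n^{2-ε})`-time algorithm for any `ε > 0`. [folklore] -/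
theorem threeSUMConjectureDet_iff_kSUM_three :
    ThreeSUMConjectureDet ↔ ∀ ε : ℝ, 0 < ε → ¬ (kSUM 3).InTimeO fun n => (n : ℝ) ^ (2 - ε) := by
  rw [ThreeSUMConjectureDet, threeSUM_eq_kSUM_three]

/-- **Discharge of `subcubicEquivalent_APSP_minPlusProduct`** (Vassilevska Williams–Williams,
J. ACM 65 (2018), Thm. 1.1, (1) ⟺ (5): "The following problems … either all have truly subcubic
algorithms, or none of them do: (1) The all-pairs shortest paths problem on weighted digraphs
(APSP). … (5) Computing the matrix product over the (min,+)-semiring"; the equivalence of (1) and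
(5) was the previously known one, §2 p. 27:8 and the product gadget of the proof of Thm. 5.1,
p. 27:22): for every weight exponent there are subcubic fine-grained reductions in both directions,
both verified word-RAM oracle programs (`APSPPower.APSP_fgReducible_minPlusProduct_holds`,
`minPlusProduct_fgReducible_APSP_holds`).
[cite: VassilevskaWilliamsWilliams2018, Thm. 1.1 ((1) ⟺ (5), p. 27:3; §2 p. 27:8; proof of Thm. 5.1 p. 27:22)] -/
theorem subcubicEquivalent_APSP_minPlusProduct_holds : subcubicEquivalent_APSP_minPlusProduct :=
  subcubicEquivalent_APSP_minPlusProduct_of_reductions APSPPower.APSP_fgReducible_minPlusProduct_holds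
    minPlusProduct_fgReducible_APSP_holds

/-! ## `fine-grained.S13` uncorrected: the transfer property as first transcribed is false

See the module docstring, *Status of `trulySubTime_of_fgReducible`*. The two uncorrected
transcriptions formerly vendored as named facts in `Conjectures` (S13,
`trulySubTime_of_fgReducible`, and its S12 family consequence,
`SubcubicEquivalentFamily.trulySubTime_iff`, both until 2026-08-15) are refuted by kernel-checked
theorems stating the refuted propositions inlined, verbatim, so nothing depends on the retired
names, and neither proposition has, or can have, a `…_holds` discharge: S13 by the prelude's
`FGReducible.trulySubTime_false` (`Literature.Computability.Cryptography.FGComplexityRefutation`;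
used directly below — its in-file restatement `trulySubTime_of_fgReducible_false` was removed on
2026-08-15 as a duplicate), the family version by `SubcubicEquivalentFamily.trulySubTime_iff_false`
below. -/

/-- **The uncorrected and the corrected S13 statements side by side** (V. Vassilevska Williams
ICM 2018, §2.2, the remark following Def. 2.1 — "if `A ≤_{a,b} B` and `B` has an algorithm with
running time `O(b(n)^{1-ε})`, then … a runtime of `O(a(n)^{1-δ})` for `A` for some `δ > 0`" —
transcribed for the budgets `a = n^α`, `b = n^β` and well-formed problems, `IsStandard`): they
differ exactly on problems whose size measure does not fit in a word. The corrected transcription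
(`trulySubTime_of_fgReducible_of_sizeFitsWord`, carrying print's standing hypothesis that `n` is
the input length on a word RAM with `O(log n)`-bit words, §1, as `A.SizeFitsWord`) holds; the
uncorrected one — the second conjunct's negated proposition, inlined verbatim: until 2026-08-15
the named fact `trulySubTime_of_fgReducible` of `Literature.Computability.FineGrained.Conjectures` —
fails in the word-RAM model, by the counterexample `(univA, n¹) ≤_FG (univB, n²)` of
`Literature.Computability.Cryptography.FGComplexityRefutation` (`FGReducible.trulySubTime_false`).
[cite: VassilevskaWilliamsICM2018, §2.2 Def. 2.1 and the remark following it] -/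
theorem trulySubTime_of_fgReducible_of_sizeFitsWord_holds_and_not :
    trulySubTime_of_fgReducible_of_sizeFitsWord ∧
      ¬ (∀ {A B : FGProblem} {α β : ℝ}
          (h : FGReducible A (fun n => (n : ℝ) ^ α) B (fun n => (n : ℝ) ^ β))
          (hB : B.TrulySubTime β) (hA : A.IsStandard fun n => (n : ℝ) ^ α)
          (hB' : B.IsStandard fun n => (n : ℝ) ^ β), A.TrulySubTime α) :=
  ⟨trulySubTime_of_fgReducible_of_sizeFitsWord_holds, FGReducible.trulySubTime_false⟩

/-- **The uncorrected family transfer (`fine-grained.S12` as first transcribed) is refuted** (the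
family form of VW–W, J. ACM 65 (2018), Thm. 1.1 / §3 Prop. 2 with Def. 3.1, "either all of them
have truly subcubic algorithms, or none of them do", transcribed for *arbitrary* subcubically
equivalent families of well-formed problems, i.e. without tying the size measures to the input
length — print's Prop. 2 is about "computational problems on `n × n` matrices", p. 27:11; until
2026-08-15 the named fact `SubcubicEquivalentFamily.trulySubTime_iff` of
`Literature.Computability.FineGrained.Conjectures`, derived there from the uncorrected transfer
property, whose body is the negated proposition below): the constant families of the
counterexample `univAPow 3 ≡₃ univB` of
`Literature.Computability.Cryptography.FGComplexityRefutation`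
(`exists_subcubicEquivalent_not_trulySubTime`: both problems well formed for `n³`, `univB` truly
subcubic, `univAPow 3` solved by no word-RAM program) are subcubically equivalent families
(`SubcubicEquivalentFamily.of_subcubicEquivalent`) violating the transfer. Corrected, proved
statement: `SubcubicEquivalentFamily.trulySubTime_iff_of_sizeFitsWord_holds` (hypotheses
`SizeFitsWord` on both families).
[cite: VassilevskaWilliamsWilliams2018, §3, Def. 3.1 and Prop. 2] -/
theorem SubcubicEquivalentFamily.trulySubTime_iff_false :
    ¬ (∀ {A B : ℕ → FGProblem} (h : SubcubicEquivalentFamily A B)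
        (hA : ∀ c, (A c).IsStandard fun n => (n : ℝ) ^ (3 : ℝ))
        (hB : ∀ c, (B c).IsStandard fun n => (n : ℝ) ^ (3 : ℝ)),
        (∀ c, (A c).TrulySubTime 3) ↔ ∀ c, (B c).TrulySubTime 3) := by
  intro h
  obtain ⟨A, B, hAB, hA, hB, hBt, hAt⟩ := exists_subcubicEquivalent_not_trulySubTime
  exact hAt 3 ((h (SubcubicEquivalentFamily.of_subcubicEquivalent hAB) (fun _ => hA)
    (fun _ => hB)).2 (fun _ => hBt) 0)


/-! ## The OV hypothesis is the `k = 2` case of the `k`-OV hypothesis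

Transfer of running-time bounds along encoding-preserving instance maps, and the identification of
`kOVWithDim 2 c` with `OVWithDim c` (same input words `n :: d ::` rows of the first list, then rows
of the second; same size `n`; same answer), the `k = 2` case of the `k`-OV problem of
Pătraşcu–Williams, SODA 2010 and VVW ICM 2018, §3. -/

/-- Deterministic per-instance time bounds transfer along a map of instances `f : Q.Inst → P.Inst`
that preserves the input words and does not enlarge the accepted outputs: a program solving `P`
solves every `Q`-instance `a`, which *is* the `P`-instance `f a` on the machine (same input, hence
same word size `k · inputWidth`). [folklore] -/
theorem inTimeInst_of_instanceMap {P Q : FGProblem} (f : Q.Inst → P.Inst)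
    (henc : ∀ a, P.encode (f a) = Q.encode a) (hgood : ∀ a, P.Good (f a) ⊆ Q.Good a)
    {T : P.Inst → ℕ} (h : P.InTimeInst T) : Q.InTimeInst fun a => T (f a) := by
  obtain ⟨M, k, hd, ho, hM⟩ := h
  refine ⟨M, k, hd, ho, fun a => ?_⟩
  obtain ⟨out, hout, hrun⟩ := hM (f a)
  refine ⟨out, hgood a hout, ?_⟩
  have hw : P.width (f a) = Q.width a := by
    unfold FGProblem.width
    rw [henc]
  rw [← hw, ← henc]
  exact hrun

/-- Deterministic time bounds `T(n)` transfer along a map of instances preserving input words,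
size and (weakly) accepted outputs. [folklore] -/
theorem inTime_of_instanceMap {P Q : FGProblem} (f : Q.Inst → P.Inst)
    (henc : ∀ a, P.encode (f a) = Q.encode a) (hsize : ∀ a, P.size (f a) = Q.size a)
    (hgood : ∀ a, P.Good (f a) ⊆ Q.Good a) {T : ℕ → ℝ} (h : P.InTime T) : Q.InTime T := by
  have h' := inTimeInst_of_instanceMap f henc hgood h
  unfold FGProblem.InTime
  convert h' using 2 with a
  rw [hsize]

/-- `O(t)` time bounds transfer along a map of instances preserving input words, size and (weakly)
accepted outputs. [folklore] -/
theorem inTimeO_of_instanceMap {P Q : FGProblem} (f : Q.Inst → P.Inst)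
    (henc : ∀ a, P.encode (f a) = Q.encode a) (hsize : ∀ a, P.size (f a) = Q.size a)
    (hgood : ∀ a, P.Good (f a) ⊆ Q.Good a) {t : ℕ → ℝ} (h : P.InTimeO t) : Q.InTimeO t := by
  obtain ⟨C, hC⟩ := h
  exact ⟨C, inTime_of_instanceMap f henc hsize hgood hC⟩

/-- Concatenation over the two indices of `Fin 2`. [folklore] -/
theorem flatMap_finRange_two {α : Type*} (g : Fin 2 → List α) :
    (List.finRange 2).flatMap g = g 0 ++ g 1 := by
  simp [List.finRange_succ]

/-- The input words of a `2`-OV instance are those of the OV instance with lists `vecs 0`, `vecs 1`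
(`n :: d ::` the rows of the first list, then the rows of the second). [folklore] -/
theorem _root_.Literature.Computability.Cryptography.KOVInstance.encode_two_eq (J : KOVInstance 2) :
    (⟨J.n, J.d, J.vecs 0, J.vecs 1⟩ : OVInstance).encode = J.encode := by
  simp only [OVInstance.encode, KOVInstance.encode, flatMap_finRange_two]

/-- The input words of an OV instance are those of the `2`-OV instance with lists `![A, B]`.
[folklore] -/
theorem _root_.Literature.Computability.Cryptography.OVInstance.encode_eq_kOV_two (I : OVInstance) :
    (⟨I.n, I.d, ![I.A, I.B]⟩ : KOVInstance 2).encode = I.encode := by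
  rw [← KOVInstance.encode_two_eq]
  rfl

/-- A `2`-OV instance has an orthogonal `2`-tuple iff the OV instance with lists `vecs 0`, `vecs 1`
has an orthogonal pair (coordinatewise product zero ⟺ no coordinate where both are `true`).
[folklore] -/
theorem _root_.Literature.Computability.Cryptography.KOVInstance.hasOrthogonalTuple_two_iff
    (J : KOVInstance 2) :
    J.HasOrthogonalTuple ↔ (⟨J.n, J.d, J.vecs 0, J.vecs 1⟩ : OVInstance).HasOrthogonalPair := by
  constructor
  · rintro ⟨c, hc⟩
    refine ⟨c 0, c 1, fun t ht => ?_⟩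
    have h2 : J.vecs 0 (c 0) t = false ∨ J.vecs 1 (c 1) t = false := by
      have := hc t
      rwa [Fin.exists_fin_two] at this
    rcases h2 with h0 | h1
    · exact Bool.false_ne_true (h0.symm.trans ht.1)
    · exact Bool.false_ne_true (h1.symm.trans ht.2)
  · rintro ⟨i, j, h⟩
    refine ⟨![i, j], fun t => ?_⟩
    have ht := h t
    cases hA : J.vecs 0 i t
    · exact ⟨0, by simpa using hA⟩
    · cases hB : J.vecs 1 j t
      · exact ⟨1, by simpa using hB⟩
      · exact absurd ⟨hA, hB⟩ ht

/-- Accepted outputs agree: a `2`-OV instance and the OV instance with lists `vecs 0`, `vecs 1`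
are both yes-instances or both no-instances. [folklore] -/
theorem kOV_two_good_eq (J : KOVInstance 2) :
    (kOV 2).Good J = OV.Good (⟨J.n, J.d, J.vecs 0, J.vecs 1⟩ : OVInstance) := by
  by_cases h : J.HasOrthogonalTuple
  · have h' := (KOVInstance.hasOrthogonalTuple_two_iff J).1 h
    simp only [kOV, OV, FGProblem.ofPred_good_of_pos _ _ _ _ h,
      FGProblem.ofPred_good_of_pos _ _ _ _ h']
  · have h' : ¬ (⟨J.n, J.d, J.vecs 0, J.vecs 1⟩ : OVInstance).HasOrthogonalPair :=
      fun h'' => h ((KOVInstance.hasOrthogonalTuple_two_iff J).2 h'')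
    simp only [kOV, OV, FGProblem.ofPred_good_of_neg _ _ _ _ h,
      FGProblem.ofPred_good_of_neg _ _ _ _ h']

/-- Accepted outputs agree: an OV instance and the `2`-OV instance with lists `![A, B]`.
[folklore] -/
theorem OV_good_eq_kOV_two (I : OVInstance) :
    OV.Good I = (kOV 2).Good (⟨I.n, I.d, ![I.A, I.B]⟩ : KOVInstance 2) := by
  rw [kOV_two_good_eq]
  rfl

/-- **`2`-OV is OV**: for every dimension constant `c` and every time bound `t`, `k`-OV with
`k = 2` in dimension `d = c ⌊log₂ n⌋` (`kOVWithDim 2 c`) is in deterministic time `O(t)` iff OV in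
dimension `d = c ⌊log₂ n⌋` (`OVWithDim c`) is — the two problems have literally the same input
words, size and answers, so the same word-RAM program serves both. [folklore] -/
theorem kOVWithDim_two_inTimeO_iff (c : ℕ) (t : ℕ → ℝ) :
    (kOVWithDim 2 c).InTimeO t ↔ (OVWithDim c).InTimeO t := by
  constructor
  · intro h
    refine inTimeO_of_instanceMap (P := kOVWithDim 2 c) (Q := OVWithDim c)
      (fun a => ⟨⟨a.1.n, a.1.d, ![a.1.A, a.1.B]⟩, a.2⟩) (fun a => ?_) (fun _ => rfl)
      (fun a => ?_) h
    · exact OVInstance.encode_eq_kOV_two a.1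
    · exact (OV_good_eq_kOV_two a.1).symm.subset
  · intro h
    refine inTimeO_of_instanceMap (P := OVWithDim c) (Q := kOVWithDim 2 c)
      (fun a => ⟨⟨a.1.n, a.1.d, a.1.vecs 0, a.1.vecs 1⟩, a.2⟩) (fun a => ?_) (fun _ => rfl)
      (fun a => ?_) h
    · exact KOVInstance.encode_two_eq a.1
    · exact (kOV_two_good_eq a.1).symm.subset

/-- **The OV hypothesis is the `k = 2` case of the `k`-OV hypothesis**: `OVConjectureDet` is
equivalent to "for every `ε > 0` there is `c ≥ 1` such that `kOVWithDim 2 c` has no deterministic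
`O(n^{2-ε})`-time algorithm", the `k = 2` slice of the conclusion of
`not_kOVWithDim_inTimeO_of_sethWordRAM`. [folklore] -/
theorem ovConjectureDet_iff_kOVWithDim_two :
    OVConjectureDet ↔
      ∀ ε : ℝ, 0 < ε → ∃ c : ℕ, 1 ≤ c ∧ ¬ (kOVWithDim 2 c).InTimeO fun n => (n : ℝ) ^ (2 - ε) := by
  simp only [OVConjectureDet, kOVWithDim_two_inTimeO_iff]

/-- Savings `ε ≤ 1` suffice in `OVConjectureDet`: an `O(n^{2-ε})` algorithm is an
`O(n^{2-min(ε,1)})` one (`inTimeO_rpow_two_sub_anti`), so the hypothesis for small savings gives it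
for all. (The sources take `ε < 1` tacitly: an `o(n d)`-time algorithm cannot read the input.)
[folklore] -/
theorem ovConjectureDet_iff_forall_le_one :
    OVConjectureDet ↔ ∀ ε : ℝ, 0 < ε → ε ≤ 1 →
      ∃ c : ℕ, 1 ≤ c ∧ ¬ (OVWithDim c).InTimeO fun n => (n : ℝ) ^ (2 - ε) := by
  refine ⟨fun h ε hε _ => h ε hε, fun h ε hε => ?_⟩
  obtain ⟨c, hc, hnot⟩ := h (min ε 1) (lt_min hε one_pos) (min_le_right _ _)
  exact ⟨c, hc, fun h' => hnot (inTimeO_rpow_two_sub_anti (min_le_left _ _) h')⟩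

/-- **fine-grained.S09, two lists from `k` lists.** The named fact `ovConjectureDet_of_sethWordRAM`
(word-RAM SETH ⇒ `OVConjectureDet`; Williams 2005, Thm. 5.1; VVW ICM 2018, Thm. 3.1) is the `k = 2`
case of the `k`-list named fact `not_kOVWithDim_inTimeO_of_sethWordRAM`, by `2`-OV = OV
(`kOVWithDim_two_inTimeO_iff`). [cite: VassilevskaWilliamsICM2018, §3 Thm. 3.1] -/
theorem ovConjectureDet_of_sethWordRAM_of_kOV (h : not_kOVWithDim_inTimeO_of_sethWordRAM) :
    ovConjectureDet_of_sethWordRAM := by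
  intro hS ε hε
  obtain ⟨c, hc, hnot⟩ := h hS 2 le_rfl ε hε
  refine ⟨c, hc, fun hov => hnot ?_⟩
  rw [kOVWithDim_two_inTimeO_iff]
  simpa using hov

/-- **Williams' two-list split-and-list fact from the `k`-list one.** The word-RAM named fact
`sparseKSATInRAMTime_of_ov_subquadratic` (`OVFromSETH.lean`; Williams 2005, §5.1 Thm. 5) is the
`k = 2` case of `sparseKSATInRAMTime_of_kOV_inTimeO` (`KOVFromSETH.lean`), by `2`-OV = OV
(`kOVWithDim_two_inTimeO_iff`); this is the identification left informal in the docstring of the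
latter. [cite: WilliamsTCS2005, §5.1 Thm. 5] -/
theorem sparseKSATInRAMTime_of_ov_subquadratic_of_kOV (h : sparseKSATInRAMTime_of_kOV_inTimeO) :
    sparseKSATInRAMTime_of_ov_subquadratic := by
  intro ε hε hε1 hov k c' δ hδ
  refine h 2 le_rfl ε hε hε1 (fun c hc => ?_) k c' δ (by simpa using hδ)
  rw [kOVWithDim_two_inTimeO_iff]
  simpa using hov c hc

/-- Hence the printed theorem `ovConjectureDet_of_sethWordRAM` also assembles from the shared
sparsification fact and the `k`-list split-and-list fact (cf. `ovConjectureDet_of_sethWordRAM_of`).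
[cite: VassilevskaWilliamsICM2018, §3 Thm. 3.1] -/
theorem ovConjectureDet_of_sethWordRAM_of_kOV_facts
    (hsparse : kSATInRAMTime_of_sparseKSATInRAMTime_serf)
    (hsplit : sparseKSATInRAMTime_of_kOV_inTimeO) : ovConjectureDet_of_sethWordRAM :=
  ovConjectureDet_of_sethWordRAM_of hsparse (sparseKSATInRAMTime_of_ov_subquadratic_of_kOV hsplit)

end Literature.Computability.FineGrained
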